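import Summits.CriticalPhenomena.CardyFormulaZ2.Theses.CardyMonotoneApproach
import Summits.CriticalPhenomena.CardyFormulaZ2.Theses.CardyHausdorffMoment
import Literature.Probability.RandomPlanarGeometry.KlebanZagierTheorem2
import Literature.Probability.RandomPlanarGeometry.RectangleModulusLambda
import HarnessLib

/-!
# Birth skeleton `Lines/birth.lean` for the crux `RectValue`
(item `stmt-CriticalPhenomena-5845`; primary decl `Summit.CriticalPhenomena.CardyFormulaZ2.Theses.CardyMonotoneApproach.RectValue`
of route `route-CriticalPhenomena-CardyMonotoneApproach` (rank 3), shared VERBATIM with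
`…Theses.CardyHausdorffMoment.RectValue` of route `route-CriticalPhenomena-CardyHausdorffMoment` (rank 4);
sub-problem `CardyFormulaZ2`; BC3 skeleton registered by the skeleton registrar `skel-stmt-CriticalPhenomena-5845`,
2026-08-17. `RectValue_of` concludes the primary decl BY NAME; `RectValueHausdorffMoment_of` the twin.)

The crux ("value given existence, rectangles only"): for an axis-parallel rectangle
`R = (0,w)×(0,h)` with corner marks `pt = (ih, 0, w, w+ih)` (so the crossing `arc 0 ↔ arc 2` is the
LEFT–RIGHT crossing of the box) and any uniformizing datum `(φ, x)`, IF
`bondDomainCrossingProb R δ → L` as `δ → 0⁺` THEN `L = cardyFunction (crossRatio x)`.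

## The line: hard-way lattice limits (the route's existence output, BY NAME) ⟶ Temperley–Lieb tower
## structure = conformal block ⟶ exact ℤ² duality ⟶ Kleban–Zagier rigidity (Theorem 2, corrected —
## PROVED in the tree) ⟶ dimension 1/3 ⟶ box sandwich ⟶ uniqueness of the limit

This is the decomposition the route header itself foresees for this crux ("RectValue ⇐ TowerStructure
→ KlebanZagierUniqueness → RectValue"; engine "KlebanZagier2003 Thm 1 … (ii) exact for the hard-way
lattice limits … fed by the Temperley–Lieb / transfer-matrix tower structure"), cut so that

* the RIGIDITY step is the tree's theorem
  `Literature.Probability.RandomPlanarGeometry.KlebanZagier.theorem2_corrected` (Kleban–Zagier,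
  J. Stat. Phys. 113 (2003) §5 Thm 2 with the non-constancy hypothesis the printed statement lacks;
  `KlebanZagierTheorem2.lean`) — not the unproved named fact `KlebanZagier.theorem1`;
* the EXISTENCE input the Kleban–Zagier engine consumes is the registered statement item
  `HardWayLimits` (stmt-CriticalPhenomena-9809, `Summit.CriticalPhenomena.CardyFormulaZ2.Theses.CardyHausdorffMoment.HardWayLimits`:
  the hard-way lattice limits `lim_m P_½(LR([0,pm]×[0,qm−1]))`, `1 ≤ q < p` — filed as "reusable by every
  value-engine card on rectangles"), taken BY NAME as a hypothesis of the composition (a registered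
  obligation, admissible for the skeleton audit; in route CardyHausdorffMoment it is the output of
  `LimitsFromLogConvex LogConvexApproach`, in route CardyMonotoneApproach the existence half comes from the
  sign crux `MonotoneApproach`). No value engine in print consumes the existence of the limit of ONE
  rectangle; the crux's own hypothesis `bondDomainCrossingProb R δ → L` enters through uniqueness of
  limits at the last step, and the hard-way family supplies the function of the aspect ratio that
  Kleban–Zagier rigidity needs.

Write `a(p,q,m) := crossingProb half (p*m) (q*m-1) = P_½(LR([0,pm]×[0,qm−1]))` (the route's family) and
`LR(w,h,δ) := discreteCrossingProb half ((0,w)×(0,h)) δ {re = 0, 0 ≤ im ≤ h} {re = w, 0 ≤ im ≤ h}`.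

* `stub_sideArcs` — GEOMETRY of the corner-marked rectangle (provable now; size M–L): for `R` with
  carrier `(0,w)×(0,h)` and `pt = (ih, 0, w, w+ih)`, `R.arc 0` is the closed LEFT side and `R.arc 2`
  the closed RIGHT side (Jordan-arc bookkeeping: `arc i = boundary '' [mark i, nextMark i]` is the
  simple sub-arc of the perimeter from `pt i` to `pt (i+1)` avoiding the other two corners). Hence
  `bondDomainCrossingProb R δ = LR(w,h,δ)` definitionally.
* `stub_towerStructure` — CONFORMAL-TOWER STRUCTURE GIVEN THE HARD-WAY LIMITS (OPEN; size XL; the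
  transfer-matrix heart): if the hard-way limits exist (`HardWayLimits`, verbatim), then ALL lattice
  limits `lim_m a(p,q,m)` (`p, q ≥ 1`; easy way and diagonal follow by exact duality) are the values
  `P(p/q)` of ONE Kleban–Zagier conformal block `P(r) = Σₙ cₙ e^{−π r (n+α)}` of some dimension
  `α > 0` with coefficients of polynomial growth. Lattice origin: `a(p,q,m) = Σ_k A_k(N) μ_k(N)^{pm}`,
  `N = qm`, exactly (spectral decomposition of the stochastic Temperley–Lieb(β=1) row transfer matrix),
  scaled gaps `N log(1/μ_k(N)) → π x_k` (XXZ at Δ = −1/2, integer-spaced boundary tower) with amplitude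
  control uniform in the level.
* `stub_duality` — EXACT ℤ² DUALITY in the limit (provable now; size M): any `P` continuous on
  `(0,∞)` interpolating the lattice limits satisfies `P(1/r) = 1 − P(r)`: `a(p,q,m) + a(q,p,m) = 1`
  (`crossingProb_add_crossingProb_symm_holds` at `p = 1/2`: LR of `[0,pm]×[0,qm−1]` xor the dual TB,
  a rotated `[0,qm]×[0,pm−1]`), so `P(p/q) + P(q/p) = 1` on the positive rationals; density + continuity.
* `stub_dimension` — THE BOUNDARY EXPONENT (OPEN; size L–XL): a conformal block of dimension `α > 0`
  interpolating the lattice limits has `α = 1/3`, i.e. `−log P(r) ∼ π r/3` (Cardy's `π h_{1,3}` decay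
  of long hard-way rectangles; the route header's strip rate `σ_∞ = π/3`).
* `stub_boxSandwich` — DISCRETISATION SANDWICH (provable now; size L; HardWayGlue steps (ii)–(iii) of
  the route, with continuity of `P` in place of the value): for `P` continuous on `(0,∞)` interpolating
  the lattice limits, `LR(w,h,δ) → P(w/h)` as `δ → 0⁺` for all `w, h > 0`: the G02 discretisation of
  the open box at mesh `δ` is the full grid (`meshDomain` = the unique component), the discrete arcs of
  the two vertical sides are the extreme columns (up to their top vertex, by the closest-arc rule), so
  `crossingProb half (C_δ−1) (R_δ−2) ≤ LR(w,h,δ) ≤ crossingProb half (C_δ−1) (R_δ−1)` with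
  `C_δ δ, R_δ δ → w, h`; comparison with family members (`crossingProb_anti_left`,
  `crossingProb_mono_right`) gives `limsup ≤ P(r₁)`, `liminf ≥ P(r₂)` for rationals `r₁ < w/h < r₂`,
  and continuity of `P` at `w/h` closes the sandwich.

Composition `RectValue_of` (REAL proof, no `sorry`): from `HardWayLimits` and stub 2 get the block
`P` (dimension `α > 0`, polynomial growth) carrying all lattice limits; `P` is differentiable hence
continuous on `(0,∞)` (`KlebanZagier.hasDerivAt_P`); stub 3 gives the duality, so `P(1) = 1/2`, and
`P → 0` at `∞` (`KlebanZagier.tendsto_P_atTop`) makes `P` non-constant; `KlebanZagier.theorem2_corrected`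
gives `P = genCardyFunction α ∘ modularLambdaI` on `(0,∞)`; stub 4 pins `α = 1/3`, and
`genCardyFunction (1/3) = cardyFunction` (`Γ(4/3) = Γ(1/3)/3`, proved below) with
`modularLambdaI = lamR` gives `P(r) = F(λ(ir))`. For the crux: by stub 1,
`bondDomainCrossingProb R = LR(w,h,·)`, which tends to `P(w/h)` by stub 5; the hypothesis
`bondDomainCrossingProb R δ → L` and uniqueness of limits along `𝓝[>] 0` give `L = P(w/h) =
F(lamR (w/h)) = F(crossRatio x)` by the tree's `rectangle_crossRatio_eq_lamR`.

Device (D-0027 §3.3, as in `Cruxes/CardyRectangle/Lines/birth.lean`, `Cruxes/CardyRigidity/Lines/birth.lean`):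
each stub is a sorried theorem `Holds.stub_<name> : <full statement over tree declarations>`
(registered under the short name `stub_<name>` with that text) plus the by-name handle
`def stub_<name> : Prop := type_of% Holds.stub_<name>`; the hypotheses of `RectValue_of` are the
statement item `HardWayLimits` (by name) and the five handles, and it concludes the PRIMARY decl
`Summit.CriticalPhenomena.CardyFormulaZ2.Theses.CardyMonotoneApproach.RectValue` BY NAME;
`RectValue_of_hardWayLimits : HardWayLimits → RectValue` applies it to the five sorried stubs (which also
certifies mechanically that the handles ARE the stub statements). The item is SHARED verbatim by route
CardyHausdorffMoment (`Summit.CriticalPhenomena.CardyFormulaZ2.Theses.CardyHausdorffMoment.RectValue`, same text):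
the companions `RectValueHausdorffMoment_of` / `RectValueHausdorffMoment_of_hardWayLimits` conclude that decl BY
NAME from the same hypotheses (definitional unfolding only), so the skeleton audit passes under either
resolution of the crux decl. Sorries: exactly the five `Holds.stub_*`; nothing else.

Disproof used: none — no `Disproof.lean`, no `Negative/` lemma and no other workfile exists for this
crux at registration (`ledger crux ls stmt-CriticalPhenomena-5845`: "(no workfiles yet)", 2026-08-17);
the negatives index of the summit (11 refuted statements, 4 on this sub-problem: `not_SymmetryUpgrade`
stmt-0698, JunctionShadowing stmt-8581, degenerate arcs stmt-0748, DualCurrentTemplate stmt-6949) has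
no statement about rectangle crossing limits, lattice crossing sequences or conformal blocks; stmt-0748's
refutation (every cluster point of `bondDomainCrossingProb R` lies in `(0,1)`) is consistent with
stub 5 (`P(w/h) ∈ (0,1)`). No stub is a restatement: stubs 2–4 concern the lattice family and ONE real
function of the aspect ratio, stubs 1 and 5 contain no percolation limit of `R` at all, and
`stub → RectValue` / `stub → CardyFormulaZ2` fail the cheap probes (BC3, see `Lines/birth.md`).
-/

noncomputable section

namespace Summit.CriticalPhenomena.CardyFormulaZ2.Cruxes.RectValue.Birth

open Set Filter Topology
open Literature.Probability.RandomPlanarGeometry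
open Literature.Probability.RandomPlanarGeometry.KlebanZagier (IsConformalBlock lamR modularLambdaI
  genCardyFunction)
open Literature.Probability.Percolation (bondDomainCrossingProb discreteCrossingProb crossingProb half)
open Summit.CriticalPhenomena.CardyFormulaZ2.Theses.CardyMonotoneApproach (RectValue)
open Summit.CriticalPhenomena.CardyFormulaZ2.Theses.CardyHausdorffMoment (HardWayLimits)

/-! ### The five registered stubs (the ONLY `sorry`s of this file) and their by-name handles -/

/-- **Stub 1 — the side arcs of the corner-marked rectangle (provable now, M–L).** For a conformal
rectangle with carrier `(0,w)×(0,h)` and marks `pt 0 = ih`, `pt 1 = 0`, `pt 2 = w`, `pt 3 = w+ih`,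
the arc `(pt 0, pt 1)` is the closed left side and the arc `(pt 2, pt 3)` the closed right side
(Jordan-arc bookkeeping for `MarkedDomain.arc`; any boundary parametrisation). -/
protected theorem Holds.stub_sideArcs : ∀ (R : Literature.Probability.RandomPlanarGeometry.ConformalRectangle) (w h : ℝ), 0 < w → 0 < h → R.carrier = Set.Ioo (0:ℝ) w ×ℂ Set.Ioo (0:ℝ) h → (R.pt 0 = (h:ℂ) * Complex.I ∧ R.pt 1 = 0 ∧ R.pt 2 = (w:ℂ) ∧ R.pt 3 = (w:ℂ) + (h:ℂ) * Complex.I) → R.arc 0 = {z : ℂ | z.re = 0 ∧ 0 ≤ z.im ∧ z.im ≤ h} ∧ R.arc 2 = {z : ℂ | z.re = w ∧ 0 ≤ z.im ∧ z.im ≤ h} := by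
  sorry

/-- By-name handle of the registered stub `Holds.stub_sideArcs`. -/
def stub_sideArcs : Prop := type_of% Holds.stub_sideArcs

/-- **Stub 2 — conformal-tower structure of the lattice limits, given the hard-way limits (OPEN; XL;
the transfer-matrix heart).** If the hard-way limits `lim_m P_½(LR([0,pm]×[0,qm−1]))` exist for
`1 ≤ q < p` (the route's `HardWayLimits`, verbatim), then all the lattice limits (`p, q ≥ 1`) exist
and are the values `P(p/q)` of one Kleban–Zagier conformal block `P` of some dimension `α > 0` with
coefficients of polynomial growth (Kleban–Zagier 2003 §5, hypotheses (i′) of Theorem 2; lattice side: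
spectral decomposition of the stochastic Temperley–Lieb(β=1) transfer matrix of the strip and the
XXZ(Δ=−1/2) boundary conformal towers, with amplitude control uniform in the level). -/
protected theorem Holds.stub_towerStructure : (∀ p q : ℕ, 1 ≤ q → q < p → ∃ L : ℝ, Filter.Tendsto (fun m : ℕ ↦ Literature.Probability.Percolation.crossingProb Literature.Probability.Percolation.half (p * m) (q * m - 1)) Filter.atTop (nhds L)) → ∃ (P : ℝ → ℝ) (α : ℝ) (c : ℕ → ℝ), 0 < α ∧ Literature.Probability.RandomPlanarGeometry.KlebanZagier.IsConformalBlock P α c ∧ (∃ C k : ℝ, ∀ n : ℕ, |c n| ≤ C * ((n : ℝ) + 1) ^ k) ∧ ∀ p q : ℕ, 1 ≤ p → 1 ≤ q → Filter.Tendsto (fun m : ℕ ↦ Literature.Probability.Percolation.crossingProb Literature.Probability.Percolation.half (p * m) (q * m - 1)) Filter.atTop (nhds (P ((p : ℝ) / (q : ℝ)))) := by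
  sorry

/-- By-name handle of the registered stub `Holds.stub_towerStructure`. -/
def stub_towerStructure : Prop := type_of% Holds.stub_towerStructure

/-- **Stub 3 — exact `ℤ²` duality of the limit function (provable now, M).** A function continuous on
`(0,∞)` that interpolates the lattice limits satisfies `P (1/r) = 1 − P r` for `r > 0`: planar
duality at the self-dual point gives `P_½(LR([0,pm]×[0,qm−1])) + P_½(LR([0,qm]×[0,pm−1])) = 1`
(`crossingProb_add_crossingProb_symm_holds`, Grimmett 1999 §11.2), hence `P(p/q) + P(q/p) = 1` on the
positive rationals, and density + continuity extend it to all `r > 0`. -/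
protected theorem Holds.stub_duality : ∀ P : ℝ → ℝ, ContinuousOn P (Set.Ioi 0) → (∀ p q : ℕ, 1 ≤ p → 1 ≤ q → Filter.Tendsto (fun m : ℕ ↦ Literature.Probability.Percolation.crossingProb Literature.Probability.Percolation.half (p * m) (q * m - 1)) Filter.atTop (nhds (P ((p : ℝ) / (q : ℝ))))) → ∀ r : ℝ, 0 < r → P (1 / r) = 1 - P r := by
  sorry

/-- By-name handle of the registered stub `Holds.stub_duality`. -/
def stub_duality : Prop := type_of% Holds.stub_duality

/-- **Stub 4 — the boundary exponent: the block dimension is `1/3` (OPEN; L–XL).** A conformal block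
of dimension `α > 0` interpolating the lattice limits has `α = 1/3`, i.e. `−log P(r) ∼ π r / 3` as
`r → ∞` (Cardy 1992: `Π_h(r) ≍ e^{−π r/3}`, the `π h_{1,3}` rate; the dimension is intrinsic, the
leading exponential rate, so no growth hypothesis is needed). -/
protected theorem Holds.stub_dimension : ∀ (P : ℝ → ℝ) (α : ℝ) (c : ℕ → ℝ), 0 < α → Literature.Probability.RandomPlanarGeometry.KlebanZagier.IsConformalBlock P α c → (∀ p q : ℕ, 1 ≤ p → 1 ≤ q → Filter.Tendsto (fun m : ℕ ↦ Literature.Probability.Percolation.crossingProb Literature.Probability.Percolation.half (p * m) (q * m - 1)) Filter.atTop (nhds (P ((p : ℝ) / (q : ℝ))))) → α = 1 / 3 := by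
  sorry

/-- By-name handle of the registered stub `Holds.stub_dimension`. -/
def stub_dimension : Prop := type_of% Holds.stub_dimension

/-- **Stub 5 — the discretisation sandwich for boxes (provable now, L).** For `P` continuous on `(0,∞)`
interpolating the lattice limits, the left–right crossing probability of the G02-discretised open box
`(0,w)×(0,h)` (closed vertical sides as arcs) tends to `P (w/h)` as the mesh `δ → 0⁺`: the discretised
box is a grid whose discrete vertical arcs are its extreme columns up to their top vertex, so the
crossing probability is squeezed between `crossingProb half (C_δ−1) (R_δ−2)` and
`crossingProb half (C_δ−1) (R_δ−1)`, `C_δ δ → w`, `R_δ δ → h`; monotonicity in the box dimensions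
(`crossingProb_anti_left`, `crossingProb_mono_right`) compares these with family members of rational
aspect ratio on either side of `w/h`, and continuity of `P` at `w/h` closes the sandwich
(steps (ii)–(iii) of the route's `HardWayGlue`). -/
protected theorem Holds.stub_boxSandwich : ∀ P : ℝ → ℝ, ContinuousOn P (Set.Ioi 0) → (∀ p q : ℕ, 1 ≤ p → 1 ≤ q → Filter.Tendsto (fun m : ℕ ↦ Literature.Probability.Percolation.crossingProb Literature.Probability.Percolation.half (p * m) (q * m - 1)) Filter.atTop (nhds (P ((p : ℝ) / (q : ℝ))))) → ∀ w h : ℝ, 0 < w → 0 < h → Filter.Tendsto (fun δ : ℝ ↦ Literature.Probability.Percolation.discreteCrossingProb Literature.Probability.Percolation.half (Set.Ioo (0:ℝ) w ×ℂ Set.Ioo (0:ℝ) h) δ {z : ℂ | z.re = 0 ∧ 0 ≤ z.im ∧ z.im ≤ h} {z : ℂ | z.re = w ∧ 0 ≤ z.im ∧ z.im ≤ h}) (nhdsWithin 0 (Set.Ioi 0)) (nhds (P (w / h))) := by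
  sorry

/-- By-name handle of the registered stub `Holds.stub_boxSandwich`. -/
def stub_boxSandwich : Prop := type_of% Holds.stub_boxSandwich

/-! ### Sorry-free glue lemma used by the composition -/

/-- `genCardyFunction (1/3) = cardyFunction`: the SLE₆ member of Kleban–Zagier's family `Π_h(·;α)` is
Cardy's function (`Γ(4/3) = Γ(1/3)/3`, so `Γ(2/3)/(Γ(1/3)Γ(4/3)) = 3Γ(2/3)/Γ(1/3)²`). -/
theorem genCardyFunction_one_third (η : ℝ) : genCardyFunction (1 / 3) η = cardyFunction η := by
  have hΓ : Real.Gamma (1 + 1 / 3 : ℝ) = 1 / 3 * Real.Gamma (1 / 3) := by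
    rw [add_comm]
    exact Real.Gamma_add_one (by norm_num)
  have hΓ0 : Real.Gamma (1 / 3 : ℝ) ≠ 0 := (Real.Gamma_pos_of_pos (by norm_num)).ne'
  rw [Literature.Probability.RandomPlanarGeometry.KlebanZagier.genCardyFunction,
    Literature.Probability.RandomPlanarGeometry.cardyFunction, hΓ]
  have e1 : (2 : ℝ) * (1 / 3) = 2 / 3 := by norm_num
  have e2 : (1 : ℝ) - 1 / 3 = 2 / 3 := by norm_num
  have e3 : (1 : ℝ) + 1 / 3 = 4 / 3 := by norm_num
  have e4 : Real.Gamma (2 / 3) / (Real.Gamma (1 / 3) * (1 / 3 * Real.Gamma (1 / 3))) =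
      3 * Real.Gamma (2 / 3) / Real.Gamma (1 / 3) ^ 2 := by
    field_simp
  rw [e1, e2, e3, e4]

/-! ### Composition (sorry-free): `HardWayLimits` and the five stubs imply the crux BY NAME -/

/-- **`RectValue` (primary decl `CardyMonotoneApproach.RectValue`, BY NAME) from the statement item
`HardWayLimits` and the five stubs (real proof).** See the module docstring. -/
theorem RectValue_of (hH : HardWayLimits) (hA : stub_sideArcs) (hT : stub_towerStructure)
    (hD : stub_duality) (hα : stub_dimension) (hS : stub_boxSandwich) : RectValue := by
  dsimp only [stub_sideArcs, stub_towerStructure, stub_duality, stub_dimension, stub_boxSandwich]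
    at hA hT hD hα hS
  -- the conformal block carrying all lattice limits, from the hard-way limits (route item, by name)
  obtain ⟨P, α, c, hαpos, hblock, hgr, hlat⟩ := hT hH
  obtain ⟨C, m, hC, hcm⟩ := Literature.Probability.RandomPlanarGeometry.KlebanZagier.polyGrowth_nat hgr
  have hcont : ContinuousOn P (Set.Ioi 0) := fun t ht =>
    (Literature.Probability.RandomPlanarGeometry.KlebanZagier.hasDerivAt_P hblock hcm hC
      (Set.mem_Ioi.mp ht)).continuousAt.continuousWithinAt
  -- exact duality and the dimension
  have hdual : ∀ r : ℝ, 0 < r → P (1 / r) = 1 - P r := hD P hcont hlat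
  have hthird : α = 1 / 3 := hα P α c hαpos hblock hlat
  -- `P 1 = 1/2` (duality) and `P → 0` at `∞` (block of positive dimension): `P` is not constant
  have hone : P 1 = 1 / 2 := by
    have h := hdual 1 one_pos
    rw [div_one] at h
    linarith
  have hlim : Tendsto P atTop (𝓝 0) :=
    Literature.Probability.RandomPlanarGeometry.KlebanZagier.tendsto_P_atTop hblock hcm hC hαpos
  have hnc : ∃ r s : ℝ, 0 < r ∧ 0 < s ∧ P r ≠ P s := by
    have hev : ∀ᶠ t in atTop, dist (P t) 0 < 1 / 4 :=
      (Metric.tendsto_nhds.1 hlim) (1 / 4) (by norm_num)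
    obtain ⟨t, ht1, ht⟩ := ((eventually_ge_atTop (1 : ℝ)).and hev).exists
    refine ⟨t, 1, by linarith, one_pos, ?_⟩
    rw [hone]
    intro h
    rw [h, Real.dist_eq] at ht
    norm_num at ht
  -- Kleban–Zagier, Theorem 2 (corrected; proved in the tree): `P = Π_h(·;α) ∘ λ(i·)` on `(0,∞)`
  obtain ⟨-, -, hKZ⟩ :=
    Literature.Probability.RandomPlanarGeometry.KlebanZagier.theorem2_corrected P α c hblock hgr hdual hnc
  have hcardy : ∀ r : ℝ, 0 < r → P r = cardyFunction (lamR r) := by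
    intro r hr
    rw [hKZ r hr, hthird, genCardyFunction_one_third,
      Literature.Probability.RandomPlanarGeometry.KlebanZagier.modularLambdaI_eq_lamR hr]
  -- the crux: the box crossing probabilities of `R` tend to `P (w/h)`, and limits are unique
  intro R w h hw hh hcar hpt φ x hφx L hL
  obtain ⟨h0, h2⟩ := hA R w h hw hh hcar hpt
  have hbox : Tendsto (bondDomainCrossingProb R) (𝓝[>] 0) (𝓝 (P (w / h))) := by
    have e : bondDomainCrossingProb R = fun δ : ℝ => discreteCrossingProb half
        (Set.Ioo (0:ℝ) w ×ℂ Set.Ioo (0:ℝ) h) δ {z : ℂ | z.re = 0 ∧ 0 ≤ z.im ∧ z.im ≤ h}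
        {z : ℂ | z.re = w ∧ 0 ≤ z.im ∧ z.im ≤ h} := by
      funext δ
      show discreteCrossingProb half R.carrier δ (R.arc 0) (R.arc 2) = _
      rw [hcar, h0, h2]
    rw [e]
    exact hS P hcont hlat w h hw hh
  have hLP : L = P (w / h) := tendsto_nhds_unique hL hbox
  rw [hLP, hcardy (w / h) (div_pos hw hh),
    Literature.Probability.RandomPlanarGeometry.rectangle_crossRatio_eq_lamR R hw hh hcar hpt φ x hφx]

/-- **The crux from the existence item `HardWayLimits` and the five stubs** (depends on
`sorryAx` ONLY through the five `Holds.stub_*`; this line also certifies that the by-name handles ARE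
the stub statements). -/
theorem RectValue_of_hardWayLimits (hH : HardWayLimits) : RectValue :=
  RectValue_of hH Holds.stub_sideArcs Holds.stub_towerStructure Holds.stub_duality Holds.stub_dimension
    Holds.stub_boxSandwich

/-! ### The same crux under its other route name (shared item, identical text) -/

/-- **`CardyHausdorffMoment.RectValue` (the shared item's decl in route CardyHausdorffMoment, same
statement text) from the same hypotheses** — by definitional unfolding of the two route decls. In that
route `HardWayLimits` is the output of `LimitsFromLogConvex LogConvexApproach`. -/
theorem RectValueHausdorffMoment_of (hH : HardWayLimits) (hA : stub_sideArcs) (hT : stub_towerStructure)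
    (hD : stub_duality) (hα : stub_dimension) (hS : stub_boxSandwich) :
    Summit.CriticalPhenomena.CardyFormulaZ2.Theses.CardyHausdorffMoment.RectValue :=
  fun R w h hw hh hcar hpt φ x hφx L hL => RectValue_of hH hA hT hD hα hS R w h hw hh hcar hpt φ x hφx L hL

/-- `CardyHausdorffMoment.RectValue` from `HardWayLimits` and the five sorried stubs. -/
theorem RectValueHausdorffMoment_of_hardWayLimits (hH : HardWayLimits) :
    Summit.CriticalPhenomena.CardyFormulaZ2.Theses.CardyHausdorffMoment.RectValue :=
  RectValueHausdorffMoment_of hH Holds.stub_sideArcs Holds.stub_towerStructure Holds.stub_duality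
    Holds.stub_dimension Holds.stub_boxSandwich

end Summit.CriticalPhenomena.CardyFormulaZ2.Cruxes.RectValue.Birth

end
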